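import Summits.QuantumFields.Balaban3D.Proofs.Run3Collar
import Summits.QuantumFields.YangMills.Theorems.UnitScaleTiltHistoryTailTowerReach

/-!
# Route `UnitScaleTilt` — crux K2-L `HistoryTailL` (stmt-QuantumFields-19936), STUB 4c `stub_diluteExponent`: THE COLLAR CHAIN OF THE LANE'S REGIONS
# `Carriers.Omega` IN FINE LATTICE STEPS, WITH THE REACH SUMMED SHARPLY ALONG THE FLOW — a fine site outside `Ω_k(h)` lies within
# `Σ_{l=i}^{k−1} (Rcol_l·L^l + d·L^l + d·M₁·L^{l+1})` steps of a site covered by a large-field plaquette of some passage `i < k`, and along the printed collars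
# `Rcol_l ≤ (R₁x_l^{r₀} + 1)·M₁` this is `≤ 3·(R₁(max 1 r₀)^{r₀}M₁·x_j^{r₀} + M₁ + d + dM₁L)·L^j` at the reference level `j = k − 1`, UNIFORMLY in the source
# level (support file; the «collars vs cells» geometry of the dilute-family exponent bound on the CONCRETE lane datum)

Fleet lead `ym-ust-18916-p1` (gen 3), 2026-08-27.  The lane's `Run3Collar.collar_chain` (seat p2) measures the chain in scale-`(k−1)` units and bounds it by the
SOURCE passage's collar `2(Rcol_i + B + d) + 1` (antitone collars); `B10Eq39CollarVolume`/`HistoryTailTowerReach` (p484215) do the sharp sum for the OTHER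
region implementation (`B10Eq38TorusDomains.omegaSeq`).  Crux 19936's v5p′/v5p3 stubs are typed on alpha-1's concrete datum, whose regions ARE `Carriers.Omega`
(`AlphaInputsT3AC.OfV2At.dataT3c`), so the dilute-family exponent bound (STUB 4c) needs the sharp reach for THIS recursion:

* §1 `val_coarsen` (`(coarsen k x)_μ = x_μ / L^k` on labels), `tdist_add_le_pow_mul_sdist` (EXPANSION down `k` levels: `tdist x y + d ≤ L^k·sdist_k(x,y) + d·L^k`,
  iterating `CollarCount.tdist_le_blockOf`), `tdist_le_of_bigBlockOf_succ_eq` (two fine sites of one scale-`(k+1)` big block are `≤ d(M₁L^{k+1} − 1)` apart);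
* §2 **`exists_source_fine`** — the chain in fine steps with the accumulated widths `w_l = Rcol_l·L^l + d·L^l + d·M₁·L^{l+1}` (induction on `k` over
  `Carriers.Regions.mem_Omega_succ_self`, as `collar_chain`, but in the fine metric where no rounding accumulates);
* §3 **`sum_width_le`** — along collars `Rcol_l ≤ (R₁·x_l^{r₀} + 1)·M₁` of the flow `x_l = 1 + log(√(γL^{−(K−l)}))⁻¹` (`l ≤ j ≤ K`, `0 < γ ≤ 1`):
  `Σ_{l=i}^{j} w_l ≤ 3·(R₁(max 1 r₀)^{r₀}·x_j^{r₀}·M₁ + M₁ + d + d·M₁·L)·L^j` (`HistoryTailTowerReach.xlog_coupling_rpow_le` + the geometric series `Σ (√L)^{−s} ≤ 3`);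
  **`exists_source_within_reach`** — the two combined.

References: T. Bałaban, CMP 102 (1985) 255–275 [Balaban1985UV3] ((39) p.266, p.268); CMP 109 (1987) 249–301 [Balaban1987RG1] ((0.1) p.251).
-/

noncomputable section

open scoped BigOperators

namespace Summit.QuantumFields.YangMills.Theorems.HistoryTailLaneTowerReach

open Literature.MathematicalPhysics.QuantumFieldTheory.Balaban1983to89
open B10LargeField (xlog)
open Summit.QuantumFields.Balaban3D.Carriers
open Summit.QuantumFields.Balaban3D.Proofs.CollarCount (tdist_le_blockOf tdist_le_of_labels_div_eq)
open B3Taylor310LocalRemainder (tdist_comm tdist_triangle)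
open Summit.QuantumFields.YangMills.Theorems.HistoryTailTowerReach (xlog_coupling_rpow_le one_le_xlog_coupling three_halves_le_sqrt_L sum_inv_sqrt_pow_le)

variable {P : Params}

/-! ## §1 Labels of the coarsened sites; expansion of the torus distance down `k` levels; the diameter of a big block -/

/-- `(coarsen k x)_μ = x_μ / L^k` on the labels (standing range `k ≤ m + K`). [cite: Balaban1987RG1, (0.1) p.251] -/
theorem val_coarsen : ∀ (k : ℕ), k ≤ P.m + P.K → ∀ (x : Site P 0) (μ : Fin P.d), ((coarsen k x) μ).val = (x μ).val / P.L ^ k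
  | 0, _, x, μ => by simp [coarsen]
  | k + 1, hk, x, μ => by
    rw [coarsen_succ, Site.val_blockOf hk, val_coarsen k (by omega) x μ, Nat.div_div_eq_div_mul, pow_succ]

/-- **EXPANSION DOWN `k` LEVELS**: `tdist x y + d ≤ L^k·sdist_k(x, y) + d·L^k` (`CollarCount.tdist_le_blockOf` iterated; no rounding loss accumulates).
[cite: Balaban1987RG1, (0.1) p.251] -/
theorem tdist_add_le_pow_mul_sdist : ∀ (k : ℕ), k ≤ P.m + P.K → ∀ (x y : Site P 0),
    Site.tdist x y + P.d ≤ P.L ^ k * sdist k x y + P.d * P.L ^ k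
  | 0, _, x, y => by simp [sdist, coarsen]
  | k + 1, hk, x, y => by
    have ih := tdist_add_le_pow_mul_sdist k (by omega) x y
    have hstep : sdist k x y ≤ P.L * sdist (k + 1) x y + P.d * (P.L - 1) := by
      unfold sdist
      rw [coarsen_succ, coarsen_succ]
      exact tdist_le_blockOf hk (coarsen k x) (coarsen k y)
    have hL1 : 1 ≤ P.L := P.L_pos
    have hLsub : P.L - 1 + 1 = P.L := Nat.sub_add_cancel hL1
    have h1 : P.L ^ k * sdist k x y ≤ P.L ^ (k + 1) * sdist (k + 1) x y + P.d * P.L ^ k * (P.L - 1) := by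
      calc P.L ^ k * sdist k x y ≤ P.L ^ k * (P.L * sdist (k + 1) x y + P.d * (P.L - 1)) := Nat.mul_le_mul_left _ hstep
        _ = P.L ^ (k + 1) * sdist (k + 1) x y + P.d * P.L ^ k * (P.L - 1) := by rw [pow_succ]; ring
    have h2 : P.d * P.L ^ k * (P.L - 1) + P.d * P.L ^ k = P.d * P.L ^ (k + 1) := by
      calc P.d * P.L ^ k * (P.L - 1) + P.d * P.L ^ k = P.d * P.L ^ k * (P.L - 1 + 1) := by ring
        _ = P.d * P.L ^ (k + 1) := by rw [hLsub, pow_succ]; ring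
    omega

/-- **THE DIAMETER OF A SCALE-`(k+1)` BIG BLOCK IN FINE STEPS**: two fine sites with the same scale-`(k+1)` big block are `≤ d·(M₁·L^{k+1} − 1)` apart.
[cite: Balaban1985UV3, (39) p.266] -/
theorem tdist_le_of_bigBlockOf_succ_eq {M₁ : ℕ} (hM : 0 < M₁) {k : ℕ} (hk : k + 1 ≤ P.m + P.K) {x y : Site P 0}
    (h : bigBlockOf M₁ (k + 1) x = bigBlockOf M₁ (k + 1) y) : Site.tdist x y ≤ P.d * (M₁ * P.L ^ (k + 1) - 1) := by
  refine tdist_le_of_labels_div_eq x y (Nat.mul_pos hM (pow_pos P.L_pos _)) fun μ => ?_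
  have hμ : ((coarsen (k + 1) x) μ).val / M₁ = ((coarsen (k + 1) y) μ).val / M₁ := congrFun h μ
  rw [val_coarsen (k + 1) hk x μ, val_coarsen (k + 1) hk y μ, Nat.div_div_eq_div_mul, Nat.div_div_eq_div_mul] at hμ
  rwa [mul_comm M₁]

/-! ## §2 The collar chain in fine steps -/

/-- **THE COLLAR CHAIN OF `Carriers.Omega` IN FINE STEPS**: if `y ∉ Ω_k(h)` (`k ≤ m + K`) there are a passage `i < k`, a large-field plaquette `p ∈ P_i(h)` and a
site `c` covered by it with `tdist c y ≤ Σ_{l=i}^{k−1} (Rcol_l·L^l + d·L^l + d·M₁·L^{l+1})` — at each passage the defining clause of `Ω_{l+1}` (`mem_Omega_succ_self`)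
gives a point `y′` of the big block of `y` and a bad point `x` with `sdist_l(x, y′) ≤ Rcol_l`, i.e. `tdist x y′ ≤ Rcol_l·L^l + d·L^l` and `tdist y′ y ≤ d·M₁·L^{l+1}`.
[cite: Balaban1985UV3, (39) p.266 and p.268] -/
theorem exists_source_fine {M₁ : ℕ} (hM : 0 < M₁) (Rcol : ℕ → ℕ) :
    ∀ (k : ℕ), k ≤ P.m + P.K → ∀ (h : Hist P k) (y : Site P 0), y ∉ Omega M₁ Rcol k h k →
      ∃ (i : ℕ) (hi : i < k) (p : Plaq P i), p ∈ h ⟨i, hi⟩ ∧ ∃ c ∈ plaqCover p,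
        (Site.tdist c y : ℝ) ≤ ∑ l ∈ Finset.Ico i k, ((Rcol l : ℝ) * (P.L : ℝ) ^ l + P.d * (P.L : ℝ) ^ l + P.d * M₁ * (P.L : ℝ) ^ (l + 1)) := by
  intro k
  induction k with
  | zero =>
    intro _ h y hy
    rw [Hist.eq_triv_zero h, Omega_triv] at hy
    exact absurd (Set.mem_univ y) hy
  | succ k ih =>
    intro hk h y hy
    rw [mem_Omega_succ_self] at hy
    push Not at hy
    obtain ⟨y', hy', x, hx, hdist⟩ := hy
    -- the two links of the passage `k`
    have hlink1 : (Site.tdist x y' : ℝ) ≤ (Rcol k : ℝ) * (P.L : ℝ) ^ k + P.d * (P.L : ℝ) ^ k := by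
      have h1 := tdist_add_le_pow_mul_sdist k (by omega) x y'
      have h2 : P.L ^ k * sdist k x y' ≤ P.L ^ k * Rcol k := Nat.mul_le_mul_left _ hdist
      have h3 : Site.tdist x y' ≤ P.L ^ k * Rcol k + P.d * P.L ^ k := by omega
      have h4 : (Site.tdist x y' : ℝ) ≤ ((P.L ^ k * Rcol k + P.d * P.L ^ k : ℕ) : ℝ) := by exact_mod_cast h3
      refine h4.trans (le_of_eq ?_)
      push_cast; ring
    have hlink2 : (Site.tdist y' y : ℝ) ≤ P.d * M₁ * (P.L : ℝ) ^ (k + 1) := by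
      have h1 := tdist_le_of_bigBlockOf_succ_eq hM hk hy'
      have h2 : Site.tdist y' y ≤ P.d * (M₁ * P.L ^ (k + 1)) := h1.trans (Nat.mul_le_mul_left _ (Nat.sub_le _ _))
      have h3 : (Site.tdist y' y : ℝ) ≤ ((P.d * (M₁ * P.L ^ (k + 1)) : ℕ) : ℝ) := by exact_mod_cast h2
      refine h3.trans (le_of_eq ?_)
      push_cast; ring
    have hwk : (Site.tdist x y : ℝ) ≤ (Rcol k : ℝ) * (P.L : ℝ) ^ k + P.d * (P.L : ℝ) ^ k + P.d * M₁ * (P.L : ℝ) ^ (k + 1) := by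
      have := tdist_triangle x y' y
      have h' : (Site.tdist x y : ℝ) ≤ (Site.tdist x y' : ℝ) + (Site.tdist y' y : ℝ) := by exact_mod_cast this
      linarith
    rcases hx with ⟨p, hp, hxp⟩ | hxΩ
    · -- the source is a large-field plaquette of the last passage
      refine ⟨k, Nat.lt_succ_self k, p, hp, x, hxp, ?_⟩
      rw [Nat.Ico_succ_singleton, Finset.sum_singleton]
      exact hwk
    · -- the source lies deeper: `x ∉ Ω_k(proj h)`
      obtain ⟨i, hi, p, hp, c, hc, hci⟩ := ih (by omega) h.proj x hxΩ
      refine ⟨i, by omega, p, ?_, c, hc, ?_⟩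
      · simpa [Hist.proj] using hp
      · have htri : (Site.tdist c y : ℝ) ≤ (Site.tdist c x : ℝ) + (Site.tdist x y : ℝ) := by exact_mod_cast tdist_triangle c x y
        rw [Finset.sum_Ico_succ_top (by omega : i ≤ k)]
        linarith

/-! ## §3 The reach along the printed collars, summed sharply -/

/-- **THE ACCUMULATED WIDTHS ALONG THE FLOW**: with collars `Rcol_l ≤ (R₁·x_l^{r₀} + 1)·M₁` for `l ≤ j` (`x_l = 1 + log(√(γL^{−(K−l)}))⁻¹`, `j ≤ K`, `0 < γ ≤ 1`,
`R₁, r₀ ≥ 0`): `Σ_{l=i}^{j} (Rcol_l·L^l + d·L^l + d·M₁·L^{l+1}) ≤ 3·(R₁(max 1 r₀)^{r₀}M₁·x_j^{r₀} + M₁ + d + d·M₁·L)·L^j`. [cite: Balaban1985UV3, (39) p.266] -/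
theorem sum_width_le {γ : ℝ} (hγ : 0 < γ) (hγ1 : γ ≤ 1) (M₁ : ℕ) {R₁ r₀ : ℝ} (hR : 0 ≤ R₁) (hr : 0 ≤ r₀) {i j K : ℕ} (hj : j ≤ K)
    (Rcol : ℕ → ℕ)
    (hRcol : ∀ l, l ≤ j → (Rcol l : ℝ) ≤ (R₁ * xlog (Real.sqrt (γ * ((P.L : ℝ)⁻¹) ^ (K - l))) ^ r₀ + 1) * M₁) :
    ∑ l ∈ Finset.Icc i j, ((Rcol l : ℝ) * (P.L : ℝ) ^ l + P.d * (P.L : ℝ) ^ l + P.d * M₁ * (P.L : ℝ) ^ (l + 1)) ≤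
      3 * ((R₁ * (max 1 r₀) ^ r₀ * M₁ * xlog (Real.sqrt (γ * ((P.L : ℝ)⁻¹) ^ (K - j))) ^ r₀ + M₁ + P.d + P.d * M₁ * P.L) * (P.L : ℝ) ^ j) := by
  have hL1 : (1 : ℝ) ≤ (P.L : ℝ) := by exact_mod_cast P.hL.2.le
  have hL0 : (0 : ℝ) ≤ (P.L : ℝ) := zero_le_one.trans hL1
  set xj : ℝ := xlog (Real.sqrt (γ * ((P.L : ℝ)⁻¹) ^ (K - j))) with hxj
  set a : ℝ := Real.sqrt (P.L : ℝ) with ha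
  have ha1 : 1 ≤ a := by rw [ha]; exact Real.one_le_sqrt.mpr hL1
  have hxj0 : 0 ≤ xj ^ r₀ := Real.rpow_nonneg (zero_le_one.trans (one_le_xlog_coupling hγ hγ1 hL1 (K - j))) _
  set Cc : ℝ := (R₁ * (max 1 r₀) ^ r₀ * M₁ * xj ^ r₀ + M₁ + P.d + P.d * M₁ * P.L) * (P.L : ℝ) ^ j with hCc
  have hM0 : (0 : ℝ) ≤ (M₁ : ℝ) := Nat.cast_nonneg _
  have hd0 : (0 : ℝ) ≤ (P.d : ℝ) := Nat.cast_nonneg _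
  have hn0 : 0 ≤ (max 1 r₀) ^ r₀ := Real.rpow_nonneg (zero_le_one.trans (le_max_left _ _)) _
  have hCc0 : 0 ≤ Cc := by rw [hCc]; positivity
  -- each width is at most `Cc / a^{j−l}`
  have hterm : ∀ l ∈ Finset.Icc i j,
      (Rcol l : ℝ) * (P.L : ℝ) ^ l + P.d * (P.L : ℝ) ^ l + P.d * M₁ * (P.L : ℝ) ^ (l + 1) ≤ Cc / a ^ (j - l) := by
    intro l hl
    have hlj : l ≤ j := (Finset.mem_Icc.mp hl).2
    have has : 1 ≤ a ^ (j - l) := one_le_pow₀ ha1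
    have has0 : 0 < a ^ (j - l) := zero_lt_one.trans_le has
    rw [le_div_iff₀ has0]
    have hLl : a ^ (j - l) * a ^ (j - l) * (P.L : ℝ) ^ l = (P.L : ℝ) ^ j := by
      rw [← mul_pow, ha, Real.mul_self_sqrt hL0, ← pow_add]; congr 1; omega
    have hpow := xlog_coupling_rpow_le hγ hγ1 hL1 hlj hj hr (K := K)
    rw [← hxj, ← ha] at hpow
    have hR' := hRcol l hlj
    -- `Rcol_l ≤ (R₁ n₀^{r₀} x_j^{r₀} a^{j-l} + 1) M₁`
    have hRl : (Rcol l : ℝ) ≤ (R₁ * ((max 1 r₀) ^ r₀ * xj ^ r₀ * a ^ (j - l)) + 1) * M₁ := by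
      refine hR'.trans (mul_le_mul_of_nonneg_right ?_ hM0)
      nlinarith [mul_le_mul_of_nonneg_left hpow hR]
    have hLl0 : (0 : ℝ) ≤ (P.L : ℝ) ^ l := by positivity
    have hLl1 : (P.L : ℝ) ^ (l + 1) = (P.L : ℝ) ^ l * P.L := pow_succ _ _
    -- multiply out and compare with `Cc` using `a^{j-l} ≥ 1` and `a^{j-l}·a^{j-l}·L^l = L^j`
    have hlhs : ((Rcol l : ℝ) * (P.L : ℝ) ^ l + P.d * (P.L : ℝ) ^ l + P.d * M₁ * (P.L : ℝ) ^ (l + 1)) * a ^ (j - l) ≤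
        ((R₁ * ((max 1 r₀) ^ r₀ * xj ^ r₀ * a ^ (j - l)) + 1) * M₁ + P.d + P.d * M₁ * P.L) * (P.L : ℝ) ^ l * a ^ (j - l) := by
      rw [hLl1]
      have : (Rcol l : ℝ) * (P.L : ℝ) ^ l + P.d * (P.L : ℝ) ^ l + P.d * M₁ * ((P.L : ℝ) ^ l * P.L) =
          ((Rcol l : ℝ) + P.d + P.d * M₁ * P.L) * (P.L : ℝ) ^ l := by ring
      rw [this]
      refine mul_le_mul_of_nonneg_right (mul_le_mul_of_nonneg_right ?_ hLl0) has0.le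
      linarith
    refine hlhs.trans ?_
    have hsplit : ((R₁ * ((max 1 r₀) ^ r₀ * xj ^ r₀ * a ^ (j - l)) + 1) * M₁ + P.d + P.d * M₁ * P.L) * (P.L : ℝ) ^ l * a ^ (j - l) ≤
        (R₁ * (max 1 r₀) ^ r₀ * M₁ * xj ^ r₀ + M₁ + P.d + P.d * M₁ * P.L) * (a ^ (j - l) * a ^ (j - l) * (P.L : ℝ) ^ l) := by
      have hrest : (M₁ + P.d + P.d * M₁ * (P.L : ℝ)) * 1 ≤ (M₁ + P.d + P.d * M₁ * (P.L : ℝ)) * a ^ (j - l) :=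
        mul_le_mul_of_nonneg_left has (by positivity)
      nlinarith [mul_nonneg (mul_nonneg (mul_nonneg (mul_nonneg hR hn0) hM0) hxj0) (mul_nonneg has0.le hLl0),
        mul_nonneg hLl0 has0.le, hrest]
    rw [hLl] at hsplit
    rw [hCc]
    exact hsplit
  calc ∑ l ∈ Finset.Icc i j, ((Rcol l : ℝ) * (P.L : ℝ) ^ l + P.d * (P.L : ℝ) ^ l + P.d * M₁ * (P.L : ℝ) ^ (l + 1))
      ≤ ∑ l ∈ Finset.Icc i j, Cc / a ^ (j - l) := Finset.sum_le_sum hterm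
    _ = Cc * ∑ l ∈ Finset.Icc i j, (a ^ (j - l))⁻¹ := by
        rw [Finset.mul_sum]; exact Finset.sum_congr rfl fun l _ => div_eq_mul_inv _ _
    _ ≤ Cc * 3 := mul_le_mul_of_nonneg_left (by rw [ha]; exact sum_inv_sqrt_pow_le P i j) hCc0
    _ = 3 * Cc := mul_comm _ _

/-- **EVERY FINE SITE OUTSIDE `Ω_{j+1}(h)` OF THE LANE'S REGIONS IS WITHIN `3·(R₁(max 1 r₀)^{r₀}M₁x_j^{r₀} + M₁ + d + dM₁L)·L^j` FINE STEPS OF A SITE COVERED BY A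
LARGE-FIELD PLAQUETTE OF SOME PASSAGE `i ≤ j`** — uniformly in the source passage (collars along the flow, `j + 1 ≤ m + K`, `j ≤ K`).
[cite: Balaban1985UV3, (39) p.266 and p.268] -/
theorem exists_source_within_reach {γ : ℝ} (hγ : 0 < γ) (hγ1 : γ ≤ 1) {M₁ : ℕ} (hM : 0 < M₁) {R₁ r₀ : ℝ} (hR : 0 ≤ R₁) (hr : 0 ≤ r₀)
    {j K : ℕ} (hjK : j ≤ K) (hj : j + 1 ≤ P.m + P.K) (Rcol : ℕ → ℕ)
    (hRcol : ∀ l, l ≤ j → (Rcol l : ℝ) ≤ (R₁ * xlog (Real.sqrt (γ * ((P.L : ℝ)⁻¹) ^ (K - l))) ^ r₀ + 1) * M₁)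
    (h : Hist P (j + 1)) {y : Site P 0} (hy : y ∉ Omega M₁ Rcol (j + 1) h (j + 1)) :
    ∃ (i : ℕ) (hi : i < j + 1) (p : Plaq P i), p ∈ h ⟨i, hi⟩ ∧ ∃ c ∈ plaqCover p,
      (Site.tdist c y : ℝ) ≤
        3 * ((R₁ * (max 1 r₀) ^ r₀ * M₁ * xlog (Real.sqrt (γ * ((P.L : ℝ)⁻¹) ^ (K - j))) ^ r₀ + M₁ + P.d + P.d * M₁ * P.L) * (P.L : ℝ) ^ j) := by
  obtain ⟨i, hi, p, hp, c, hc, hd⟩ := exists_source_fine hM Rcol (j + 1) hj h y hy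
  refine ⟨i, hi, p, hp, c, hc, hd.trans ?_⟩
  have hIco : Finset.Ico i (j + 1) = Finset.Icc i j := by
    ext l; simp only [Finset.mem_Ico, Finset.mem_Icc]; omega
  rw [hIco]
  exact sum_width_le hγ hγ1 M₁ hR hr hjK Rcol hRcol

end Summit.QuantumFields.YangMills.Theorems.HistoryTailLaneTowerReach

end
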